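import Literature.NumberTheory.Sieve.BombieriFriedlanderIwaniecTheorem9CaseI
import Literature.NumberTheory.Sieve.BombieriFriedlanderIwaniecTheorem6Core
import HarnessLib

/-!
# Bombieri–Friedlander–Iwaniec 1986, §16 for Theorem 9: Case I from the CORE CASE `Q²R ≤ x` of Theorem 6

Topic `Literature/NumberTheory/Sieve`, sibling of
`Literature.NumberTheory.Sieve.BombieriFriedlanderIwaniecTheorem9CaseI`.  Everything here is PROVED;
no named fact is introduced (one parametrised hypothesis predicate, `BFI.Theorem6CoreAt a`, is
defined: the core case of Theorem 6 for one residue `a`, in the manner of `BFI.Lemma1BoundFor`).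

E. Bombieri, J. B. Friedlander, H. Iwaniec, *Primes in arithmetic progressions to large moduli*,
Acta Math. 156 (1986), 203–251.  §16 (p. 250) derives Theorem 9 from Theorems 6 and 7*, and the
tree has that derivation (`BombieriFriedlanderIwaniecTheorem9_of_theorem6_theorem7Star`,
`…Theorem9Assembly`).  The named fact `BombieriFriedlanderIwaniecTheorem6` states Theorem 6 in its
printed generality; the audit `…Theorem6Core` records that §13 (pp. 241–244) proves it under the
standing assumption **(13.1) `Q²R ≤ x`** only — the "without loss of generality" `q ↔ s` switch of
p. 241 does not go through for the abstract class (A₁)–(A₄) — and spells out the proved core case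
as the conclusion of `BombieriFriedlanderIwaniecTheorem6.core`.  This file starts the re-threading
of the §16 derivation through that core case: `BFI.Theorem6CoreAt a` is the core statement for the
residue `a` (`BFI.theorem6CoreAt_of_theorem6` derives it from the named fact through
`BombieriFriedlanderIwaniecTheorem6.core`), and `BFI.caseI_bound_core` is `BFI.caseI_bound` (Case I
of §16, (16.1): Theorem 6 on the dyadic blocks of the pair sum) with the named fact replaced by
`BFI.Theorem6CoreAt a` and the extra hypothesis `Q²R ≤ 8x` on the moduli, under which every block
`q ∼ Q/2^{k+1}`, `r ∼ R/2^{k'+1}` satisfies (13.1) at its own scale.  The moduli with `Q²R > 8x` are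
reduced to these on the side of Theorem 9 (explicit sequences), by the `q ↔ s` symmetry at the
level of `Λ` (Dirichlet\'s hyperbola method, as in the later treatments of the Titchmarsh divisor
problem), in the sequel files.

## References

* E. Bombieri, J. B. Friedlander, H. Iwaniec, *Primes in arithmetic progressions to large moduli*,
  Acta Math. 156 (1986), 203–251: §13 (A₇), (13.1) p. 241, Theorem 6 p. 244; §16 (16.1) p. 250.
  [BombieriFriedlanderIwaniecActa1986]
-/

open Finset Real
open scoped ArithmeticFunction.sigma

namespace Literature.NumberTheory.Sieve

namespace BFI

/-! ### The core case (13.1) of Theorem 6, for one residue -/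

/-- **The core case `Q²R ≤ x` of BFI\'s Theorem 6, for the residue `a`** (§13, Theorem 6 p. 244 with
the standing assumption (13.1) p. 241): the conclusion of
`BombieriFriedlanderIwaniecTheorem6.core` (the statement of the named fact
`BombieriFriedlanderIwaniecTheorem6` with the one additional hypothesis `Q ^ 2 * R ≤ x`) at a fixed
residue `a` — for `a ≠ 0`, `ε > 0`, `A > 0`, `B ≥ 0`, `Csw`, there are `B₀, B₇, C, x₀` such that for
`x ≥ x₀`, `MN = x`, `x^ε ≤ N ≤ x^{1−ε}`, `Q, R ≥ 1/2`, `Q < Q₁ ≤ 2Q`, `QR < xℒ^{−B₇}`, `Q²R ≤ x`,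
`x^εR < N < x^{−ε}(x/R)^{1/3}`, every `β` with (A₂), (A₄), every real `α`, every `δ` with
`|δ_r| ≤ τ(r)^B`: `|𝒟(M,N,Q,R; α, β, 1_{q ≤ Q₁}, δ)| ≤ C ‖α‖ ‖β‖ x^{1/2} ℒ^{−A}`.  A predicate in `a`,
used as a HYPOTHESIS below (it is what §13 proves from Lemma 1 = Deshouillers–Iwaniec; it follows
from the named fact, `BFI.theorem6CoreAt_of_theorem6`).
[cite: BombieriFriedlanderIwaniecActa1986, §13 Theorem 6 p. 244 with (13.1) p. 241] -/
def Theorem6CoreAt (a : ℤ) : Prop :=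
  a ≠ 0 → ∀ ε : ℝ, 0 < ε → ∀ A : ℝ, 0 < A → ∀ B : ℝ, 0 ≤ B → ∀ Csw : ℝ → ℝ,
    ∃ B₀ B₇ C x₀ : ℝ, ∀ x : ℝ, x₀ ≤ x → ∀ M N Q R Q₁ : ℝ,
      M * N = x → x ^ ε ≤ N → N ≤ x ^ (1 - ε) →
      1 / 2 ≤ Q → 1 / 2 ≤ R → Q < Q₁ → Q₁ ≤ 2 * Q → Q * R < x / Real.log x ^ B₇ →
      Q ^ 2 * R ≤ x →
      x ^ ε * R < N → N < x ^ (-ε) * (x / R) ^ (1 / 3 : ℝ) →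
      ∀ β : ℕ → ℝ, SiegelWalfiszHyp N B Csw β → IsSifted (dyadic N) (Real.log x ^ B₀) β →
      ∀ α δ : ℕ → ℝ, (∀ r, |δ r| ≤ (σ 0 r : ℝ) ^ B) →
        |dispD a M N Q R α β (a7Weight Q₁) δ| ≤
          C * Real.sqrt (l2Sq M α) * Real.sqrt (l2Sq N β) * x ^ (1 / 2 : ℝ) / Real.log x ^ A

/-- The named fact (Theorem 6 in its printed generality) gives the core case for every residue:
`BombieriFriedlanderIwaniecTheorem6.core`, per `a`. [cite: BombieriFriedlanderIwaniecActa1986, §13 Theorem 6 p. 244] -/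
theorem theorem6CoreAt_of_theorem6 (h : BombieriFriedlanderIwaniecTheorem6) (a : ℤ) :
    Theorem6CoreAt a :=
  fun ha => BombieriFriedlanderIwaniecTheorem6.core h a ha

/-! ### Case I of §16 on the blocks, from the core case -/

set_option maxHeartbeats 1600000 in -- Theorem 6 (core case) on `K₁K₂` blocks with ~80 hypotheses
/-- **Case I of §16 on the blocks, from the CORE CASE (13.1) of Theorem 6.**  The statement of
`BFI.caseI_bound` verbatim, with two changes: the hypothesis is the core case of Theorem 6 for the
residue `a` (`BFI.Theorem6CoreAt a`: Theorem 6 with the standing assumption (13.1) `Q²R ≤ x` of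
§13, p. 241 — what pp. 241–244 prove for the abstract class (A₁)–(A₄), see the audit in
`Literature.NumberTheory.Sieve.BombieriFriedlanderIwaniecTheorem6Core`) instead of the named fact,
and the pair sum carries the extra hypothesis `Q²R ≤ 8x`.  On the dyadic blocks `q ∼ Q' = Q/2^{k+1}`,
`r ∼ R' = R/2^{k'+1}` of `BFI.pairSum_bilinDisc_eq_sum_dispD` the nominal parameters satisfy
`Q'²R' ≤ Q²R/8 ≤ x ≤ X'`, which is (13.1) at the scale `X'` of the piece; everything else (ranges
(16.1) by `BFI.range_theorem6_of_mem`, level, (A₃), (A₄), the block count) is as in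
`BFI.caseI_bound`.  The blocks with `Q²R > 8x` are not reached by this theorem (they are reduced to
these by the `q ↔ s` switch of p. 241, carried out for the explicit sequences of Theorem 9 downstream).
[cite: BombieriFriedlanderIwaniecActa1986, §13 (13.1) p. 241, Theorem 6 p. 244; §16 (16.1) p. 250] -/
theorem caseI_bound_core {a : ℤ} (h6c : Theorem6CoreAt a) (ha : a ≠ 0)
    {e : ℝ} (he : 0 < e) (he' : e ≤ 1 / 15) {A₅ : ℝ} (hA₅ : 0 ≤ A₅) (Csw : ℝ → ℝ) :
    ∃ B C x₀ : ℝ, 0 ≤ C ∧ ∀ x : ℝ, x₀ ≤ x →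
      ∀ (X' M N t θ z Q R : ℝ) (α β : ArithmeticFunction ℝ) (δ : ℕ → ℝ),
      (∀ r, |δ r| ≤ 1) → x ≤ X' → X' ≤ 2 ^ 15 * x → M * N = X' → N = X' ^ t →
      1 ≤ Q → 1 ≤ R → 0 ≤ θ → R ≤ X' ^ θ → Q * R < x / Real.log x ^ B → Q ^ 2 * R ≤ 8 * x →
      θ + 2 * e ≤ t → t ≤ (1 - θ) / 3 - 2 * e → 2 / 15 ≤ t →
      Real.exp (Real.sqrt (Real.log x)) ≤ z →
      (∀ m, |α m| ≤ (σ 0 m : ℝ) ^ 13) → (∀ n, |β n| ≤ (σ 0 n : ℝ) ^ 13) →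
      (∀ n, β n ≠ 0 → IsRough z n) →
      SiegelWalfiszHyp N 2 Csw β →
      |∑ r ∈ (Icc 1 ⌊R⌋₊).filter (fun r : ℕ => IsCoprime (r : ℤ) a),
          δ r * ∑ q ∈ (Icc 1 ⌊Q⌋₊).filter (fun q : ℕ => IsCoprime (q : ℤ) a),
            bilinDisc a M N α β (q * r)| ≤ C * x / Real.log x ^ A₅ := by
  obtain ⟨Cl, hCl, hl2⟩ := exists_l2Sq_le_of_abs_le_sigma_zero_pow 13
  obtain ⟨E', hE'⟩ : ∃ E' : ℕ, 2 ^ (2 * 13 + 1) = 2 * E' := ⟨2 ^ 26, by norm_num⟩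
  rw [hE'] at hl2
  set A' : ℝ := A₅ + 2 * E' + 2 with hA'
  have hA'0 : 0 < A' := by rw [hA']; positivity
  obtain ⟨B₀, B₇, C₆, x₆, h6'⟩ := h6c ha e he A' hA'0 2 (by norm_num) Csw
  set B₇' : ℝ := max B₇ 0 with hB₇'
  have hB₇'0 : 0 ≤ B₇' := le_max_right _ _
  set C₆' : ℝ := max C₆ 0 with hC₆'
  have hC₆'0 : 0 ≤ C₆' := le_max_right _ _
  obtain ⟨x₂, hx₂⟩ := exists_log_rpow_lt_exp_sqrt B₀
  obtain ⟨x₀, hx₀⟩ := eventually_caseI x₆ x₂ B₇'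
  refine ⟨B₇' + 1, 16 * 2 ^ 15 * 2 ^ (2 * E') * C₆' * Cl, x₀, by positivity,
    fun x hx X' M N t θ z Q R α β δ hδ hxX hX'x hMN hNt hQ1 hR1 hθ0 hRθ hQR hQ2R ht1 ht2 ht3 hz hα hβ hβr hsw => ?_⟩
  obtain ⟨hx₆, hx₂', hxe, hx105, hLB, hL16⟩ := hx₀ x hx
  have hee : (2 : ℝ) < Real.exp (Real.exp 1) := by
    have h1 : (1 : ℝ) < Real.exp 1 := by have := Real.exp_one_gt_d9; linarith
    have h2 : Real.exp 1 < Real.exp (Real.exp 1) := Real.exp_lt_exp.2 h1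
    have := Real.exp_one_gt_d9; linarith
  have hx2 : (2 : ℝ) ≤ x := by linarith
  have hx0 : 0 < x := by linarith
  have hx1 : (1 : ℝ) ≤ x := by linarith
  have hX'2 : (2 : ℝ) ≤ X' := hx2.trans hxX
  have hX'0 : 0 < X' := by linarith
  have hX'1 : (1 : ℝ) < X' := by linarith
  set L : ℝ := Real.log x with hL
  have hL1 : 1 ≤ L := by linarith
  have hL0 : 0 < L := by linarith
  have hLX : L ≤ Real.log X' := Real.log_le_log hx0 hxX
  have hLX1 : 1 ≤ Real.log X' := hL1.trans hLX
  have hLX0 : 0 < Real.log X' := by linarith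
  have hlogX'2 : Real.log X' ≤ 2 * L := by
    have h1 : Real.log X' ≤ Real.log (2 ^ 15 * x) := Real.log_le_log hX'0 hX'x
    rw [Real.log_mul (by norm_num) hx0.ne', Real.log_pow] at h1
    have h2 : Real.log 2 < 0.6931471808 := Real.log_two_lt_d9
    push_cast at h1
    nlinarith
  -- sizes of `M` and `N`
  have ht_lt1 : t < 1 := by linarith
  have hN1 : 1 ≤ N := by rw [hNt]; exact Real.one_le_rpow hX'1.le (by linarith)
  have hNX : N ≤ X' := by
    rw [hNt]
    calc X' ^ t ≤ X' ^ (1 : ℝ) := Real.rpow_le_rpow_of_exponent_le hX'1.le ht_lt1.le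
      _ = X' := Real.rpow_one X'
  have hN0 : 0 < N := by linarith
  have hM : M = X' ^ (1 - t) := by
    have h : M = X' / N := by field_simp; linarith
    rw [h, hNt, Real.rpow_sub hX'0, Real.rpow_one]
  have hM1 : 1 ≤ M := by rw [hM]; exact Real.one_le_rpow hX'1.le (by linarith)
  have hMX : M ≤ X' := by
    rw [hM]
    calc X' ^ (1 - t) ≤ X' ^ (1 : ℝ) := Real.rpow_le_rpow_of_exponent_le hX'1.le (by linarith)
      _ = X' := Real.rpow_one X'
  have hM0 : 0 < M := by linarith
  -- sizes of `Q`, `R`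
  have hQ0 : 0 ≤ Q := by linarith
  have hR0 : 0 ≤ R := by linarith
  have hLBpos : 0 < L ^ (B₇' + 1) := Real.rpow_pos_of_pos hL0 _
  have hQRx : Q * R < x := by
    refine hQR.trans_le ?_
    rw [div_le_iff₀ hLBpos]
    have : 1 ≤ L ^ (B₇' + 1) := Real.one_le_rpow hL1 (by linarith)
    nlinarith
  have hQX : Q ≤ X' := by nlinarith
  have hRX : R ≤ X' := by nlinarith
  obtain ⟨K₁, hK₁, hK₁'⟩ := exists_pow_two_near hQ1
  obtain ⟨K₂, hK₂, hK₂'⟩ := exists_pow_two_near hR1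
  -- replace `δ` by `δ' = δ·1_{r ≠ 0}` (hypothesis (A₃) with exponent `2`)
  set δ' : ℕ → ℝ := fun r => if r = 0 then 0 else δ r with hδ'
  have hδ'A3 : ∀ r, |δ' r| ≤ (σ 0 r : ℝ) ^ (2 : ℝ) := by
    intro r
    rcases Nat.eq_zero_or_pos r with rfl | hr
    · simp [hδ']
    · have h1 : (1 : ℝ) ≤ (σ 0 r : ℝ) := by exact_mod_cast one_le_sigma_zero hr.ne'
      simp only [hδ', if_neg hr.ne']
      exact (hδ r).trans (Real.one_le_rpow h1 (by norm_num))
  have hδδ' : ∑ r ∈ (Icc 1 ⌊R⌋₊).filter (fun r : ℕ => IsCoprime (r : ℤ) a),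
      δ r * ∑ q ∈ (Icc 1 ⌊Q⌋₊).filter (fun q : ℕ => IsCoprime (q : ℤ) a), bilinDisc a M N α β (q * r) =
      ∑ r ∈ (Icc 1 ⌊R⌋₊).filter (fun r : ℕ => IsCoprime (r : ℤ) a),
        δ' r * ∑ q ∈ (Icc 1 ⌊Q⌋₊).filter (fun q : ℕ => IsCoprime (q : ℤ) a), bilinDisc a M N α β (q * r) := by
    refine Finset.sum_congr rfl fun r hr => ?_
    have hr1 : 1 ≤ r := (mem_Icc.1 (mem_filter.1 hr).1).1
    simp only [hδ', if_neg (by omega : r ≠ 0)]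
  rw [hδδ', pairSum_bilinDisc_eq_sum_dispD a M N α β δ' hQ0 hR0 hK₁ hK₂]
  -- hypotheses (A₄) for `β`
  have hzB : Real.log X' ^ B₀ < z := (hx₂ x X' hx₂' hxX hX'x).trans_le hz
  have hsift : IsSifted (dyadic N) (Real.log X' ^ B₀) β :=
    isSifted_of_rough_support hzB _ β.map_zero hβr
  -- the level: `x/L^{B₇'+1} ≤ X'/(log X')^{B₇}`
  have hlevel : x / L ^ (B₇' + 1) ≤ X' / Real.log X' ^ B₇ := by
    have h1 : Real.log X' ^ B₇ ≤ Real.log X' ^ B₇' :=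
      Real.rpow_le_rpow_of_exponent_le hLX1 (le_max_left _ _)
    have h2 : Real.log X' ^ B₇' ≤ (2 * L) ^ B₇' := Real.rpow_le_rpow hLX0.le hlogX'2 hB₇'0
    have h3 : (2 * L) ^ B₇' = 2 ^ B₇' * L ^ B₇' := Real.mul_rpow (by norm_num) hL0.le
    have h4 : 2 ^ B₇' * L ^ B₇' ≤ L ^ (B₇' + 1) := by
      rw [Real.rpow_add hL0, Real.rpow_one, mul_comm]
      exact mul_le_mul_of_nonneg_left hLB (Real.rpow_nonneg hL0.le _)
    have hpos : 0 < Real.log X' ^ B₇ := Real.rpow_pos_of_pos hLX0 _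
    calc x / L ^ (B₇' + 1) ≤ x / Real.log X' ^ B₇ := by
          refine div_le_div_of_nonneg_left hx0.le hpos ?_
          linarith
      _ ≤ X' / Real.log X' ^ B₇ := div_le_div_of_nonneg_right hxX hpos.le
  -- the ranges of `N` (Theorem 6 with `ε = e`)
  have hNlow : X' ^ e ≤ N := by
    rw [hNt]; exact Real.rpow_le_rpow_of_exponent_le hX'1.le (by linarith)
  have hNup : N ≤ X' ^ (1 - e) := by
    rw [hNt]; exact Real.rpow_le_rpow_of_exponent_le hX'1.le (by linarith)
  -- the block bound
  set Bblk : ℝ := C₆' * Cl * X' * (2 * Real.log X') ^ (2 * E') / Real.log X' ^ A' with hBblk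
  have hBblk0 : 0 ≤ Bblk := by rw [hBblk]; positivity
  have hblock : ∀ k, k < K₁ → ∀ k', k' < K₂ →
      |dispD a M N (Q / 2 ^ (k + 1)) (R / 2 ^ (k' + 1)) α β (a7Weight (Q / 2 ^ k)) δ'| ≤ Bblk := by
    intro k hk k' hk'
    set Q' : ℝ := Q / 2 ^ (k + 1) with hQ'
    set R' : ℝ := R / 2 ^ (k' + 1) with hR'
    have hQ'0 : 1 / 2 ≤ Q' := by
      rw [hQ', le_div_iff₀ (by positivity)]
      have hpow : (2 : ℝ) ^ (k + 1) ≤ 2 ^ K₁ := pow_le_pow_right₀ (by norm_num) hk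
      linarith
    have hR'0 : 1 / 2 ≤ R' := by
      rw [hR', le_div_iff₀ (by positivity)]
      have hpow : (2 : ℝ) ^ (k' + 1) ≤ 2 ^ K₂ := pow_le_pow_right₀ (by norm_num) hk'
      linarith
    have hQ'pos : 0 < Q' := by linarith
    have hR'pos : 0 < R' := by linarith
    have hQ'Q : Q' ≤ Q / 2 := by
      rw [hQ']; exact div_le_div_of_nonneg_left hQ0 (by norm_num) (le_self_pow₀ (by norm_num) (by omega))
    have hR'R : R' ≤ R / 2 := by
      rw [hR']; exact div_le_div_of_nonneg_left hR0 (by norm_num) (le_self_pow₀ (by norm_num) (by omega))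
    -- `Q₁ = 2Q' = Q/2^k`
    have hQ₁ : Q / 2 ^ k = 2 * Q' := by rw [hQ', pow_succ]; field_simp
    have hQ'Q₁ : Q' < Q / 2 ^ k := by rw [hQ₁]; linarith
    have hQ₁2 : Q / 2 ^ k ≤ 2 * Q' := by rw [hQ₁]
    -- level of the block
    have hQ'R' : Q' * R' < X' / Real.log X' ^ B₇ := by
      have h1 : Q' * R' ≤ Q * R := by
        calc Q' * R' ≤ (Q / 2) * (R / 2) := mul_le_mul hQ'Q hR'R hR'pos.le (by linarith)
          _ ≤ Q * R := by nlinarith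
      exact (h1.trans_lt hQR).trans_le hlevel
    -- (13.1) on the block: `Q'² R' ≤ Q²R/8 ≤ x ≤ X'`
    have h131 : Q' ^ 2 * R' ≤ X' := by
      have h2k : (2 : ℝ) ≤ 2 ^ (k + 1) := by
        calc (2 : ℝ) = 2 ^ 1 := (pow_one _).symm
          _ ≤ 2 ^ (k + 1) := pow_le_pow_right₀ (by norm_num) (by omega)
      have h2k' : (2 : ℝ) ≤ 2 ^ (k' + 1) := by
        calc (2 : ℝ) = 2 ^ 1 := (pow_one _).symm
          _ ≤ 2 ^ (k' + 1) := pow_le_pow_right₀ (by norm_num) (by omega)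
      have hQ'le : Q' ≤ Q / 2 := by
        rw [hQ']; exact div_le_div_of_nonneg_left hQ0 (by norm_num) h2k
      have hR'le : R' ≤ R / 2 := by
        rw [hR']; exact div_le_div_of_nonneg_left hR0 (by norm_num) h2k'
      have hQ'sq : Q' ^ 2 ≤ (Q / 2) ^ 2 := pow_le_pow_left₀ hQ'pos.le hQ'le 2
      calc Q' ^ 2 * R' ≤ (Q / 2) ^ 2 * (R / 2) := mul_le_mul hQ'sq hR'le hR'pos.le (by positivity)
        _ = Q ^ 2 * R / 8 := by ring
        _ ≤ x := by linarith
        _ ≤ X' := hxX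
    -- range (16.1)
    obtain ⟨hr1, hr2⟩ := range_theorem6_of_mem (θ' := θ) he le_rfl ht1 ht2
    have hRN : X' ^ e * R' < N := by
      have h1 : R' < X' ^ θ := by
        calc R' ≤ R / 2 := hR'R
          _ < R := by linarith
          _ ≤ X' ^ θ := hRθ
      calc X' ^ e * R' < X' ^ e * X' ^ θ := mul_lt_mul_of_pos_left h1 (Real.rpow_pos_of_pos hX'0 _)
        _ = X' ^ (e + θ) := by rw [← Real.rpow_add hX'0]
        _ ≤ X' ^ t := Real.rpow_le_rpow_of_exponent_le hX'1.le hr1.le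
        _ = N := hNt.symm
    have hNR : N < X' ^ (-e) * (X' / R') ^ (1 / 3 : ℝ) := by
      have hR'θ : R' ≤ X' ^ θ := by
        calc R' ≤ R / 2 := hR'R
          _ ≤ R := by linarith
          _ ≤ X' ^ θ := hRθ
      have h1 : X' ^ (1 - θ) ≤ X' / R' := by
        rw [Real.rpow_sub hX'0, Real.rpow_one]
        exact div_le_div_of_nonneg_left hX'0.le hR'pos hR'θ
      have h2 : X' ^ ((1 - θ) / 3) ≤ (X' / R') ^ (1 / 3 : ℝ) := by
        calc X' ^ ((1 - θ) / 3) = (X' ^ (1 - θ)) ^ (1 / 3 : ℝ) := by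
              rw [← Real.rpow_mul hX'0.le]; ring_nf
          _ ≤ (X' / R') ^ (1 / 3 : ℝ) := Real.rpow_le_rpow (Real.rpow_nonneg hX'0.le _) h1 (by norm_num)
      calc N = X' ^ t := hNt
        _ < X' ^ (-e + (1 - θ) / 3) := Real.rpow_lt_rpow_of_exponent_lt hX'1 hr2
        _ = X' ^ (-e) * X' ^ ((1 - θ) / 3) := Real.rpow_add hX'0 _ _
        _ ≤ X' ^ (-e) * (X' / R') ^ (1 / 3 : ℝ) :=
            mul_le_mul_of_nonneg_left h2 (Real.rpow_nonneg hX'0.le _)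
    have h := h6' X' (hx₆.trans hxX) M N Q' R' (Q / 2 ^ k) hMN hNlow hNup hQ'0 hR'0 hQ'Q₁ hQ₁2 hQ'R'
      h131 hRN hNR β hsw hsift α δ' hδ'A3
    refine h.trans ?_
    -- `‖α‖ ‖β‖ X'^{1/2} ≤ Cl X' (2 log X')^{2E'}`
    have hαn := sqrt_l2Sq_le hM1 hMX hX'2 hCl (hl2 M hM1 α hα)
    have hβn := sqrt_l2Sq_le hN1 hNX hX'2 hCl (hl2 N hN1 β hβ)
    have hprod : Real.sqrt (l2Sq M α) * Real.sqrt (l2Sq N β) * X' ^ (1 / 2 : ℝ) ≤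
        Cl * X' * (2 * Real.log X') ^ (2 * E') := by
      calc Real.sqrt (l2Sq M α) * Real.sqrt (l2Sq N β) * X' ^ (1 / 2 : ℝ)
          ≤ (Real.sqrt Cl * Real.sqrt M * (2 * Real.log X') ^ E') *
              (Real.sqrt Cl * Real.sqrt N * (2 * Real.log X') ^ E') * X' ^ (1 / 2 : ℝ) := by
            gcongr
      _ = (Real.sqrt Cl * Real.sqrt Cl) * (Real.sqrt M * Real.sqrt N * X' ^ (1 / 2 : ℝ)) *
            ((2 * Real.log X') ^ E' * (2 * Real.log X') ^ E') := by ring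
      _ = Cl * X' * (2 * Real.log X') ^ (2 * E') := by
          have h1 : Real.sqrt Cl * Real.sqrt Cl = Cl := Real.mul_self_sqrt hCl.le
          have h2 : Real.sqrt M * Real.sqrt N * X' ^ (1 / 2 : ℝ) = X' := by
            rw [← Real.sqrt_mul hM0.le, hMN, ← Real.sqrt_eq_rpow, Real.mul_self_sqrt hX'0.le]
          rw [h1, h2, ← pow_add, ← two_mul]
    have h0 : 0 ≤ Real.sqrt (l2Sq M α) * Real.sqrt (l2Sq N β) * X' ^ (1 / 2 : ℝ) := by positivity
    calc C₆ * Real.sqrt (l2Sq M α) * Real.sqrt (l2Sq N β) * X' ^ (1 / 2 : ℝ) / Real.log X' ^ A'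
        = C₆ * (Real.sqrt (l2Sq M α) * Real.sqrt (l2Sq N β) * X' ^ (1 / 2 : ℝ)) / Real.log X' ^ A' := by
          ring
      _ ≤ C₆' * (Cl * X' * (2 * Real.log X') ^ (2 * E')) / Real.log X' ^ A' := by
          refine div_le_div_of_nonneg_right ?_ (Real.rpow_nonneg hLX0.le _)
          exact mul_le_mul (le_max_left _ _) hprod h0 hC₆'0
      _ = Bblk := by rw [hBblk]; ring
  refine (abs_sum_sum_range_le hblock).trans ?_
  -- counting blocks, `log X'` versus `log x`
  have hK₁le : (K₁ : ℝ) ≤ 4 * Real.log X' := natCast_le_four_mul_log hK₁' hQ1 hX'2 hQX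
  have hK₂le : (K₂ : ℝ) ≤ 4 * Real.log X' := natCast_le_four_mul_log hK₂' hR1 hX'2 hRX
  have hpow : Real.log X' ^ (2 * E' + 2) / Real.log X' ^ A' ≤ (Real.log x ^ A₅)⁻¹ := by
    rw [← Real.rpow_natCast, ← Real.rpow_sub hLX0, ← Real.rpow_neg (by linarith)]
    have heq : ((2 * E' + 2 : ℕ) : ℝ) - A' = -A₅ := by rw [hA']; push_cast; ring
    rw [heq]
    exact Real.rpow_le_rpow_of_nonpos (by linarith) hLX (by linarith)
  calc (K₁ : ℝ) * K₂ * Bblk ≤ (4 * Real.log X') * (4 * Real.log X') * Bblk := by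
        have hK₂0 : (0 : ℝ) ≤ K₂ := Nat.cast_nonneg _
        exact mul_le_mul_of_nonneg_right (mul_le_mul hK₁le hK₂le hK₂0 (by positivity)) hBblk0
    _ = 16 * 2 ^ (2 * E') * C₆' * Cl * X' *
          (Real.log X' ^ (2 * E' + 2) / Real.log X' ^ A') := by
        rw [hBblk, mul_pow]; ring
    _ ≤ 16 * 2 ^ (2 * E') * C₆' * Cl * (2 ^ 15 * x) * (Real.log x ^ A₅)⁻¹ := by
        refine mul_le_mul (mul_le_mul_of_nonneg_left hX'x (by positivity)) hpow (by positivity)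
          (by positivity)
    _ = 16 * 2 ^ 15 * 2 ^ (2 * E') * C₆' * Cl * x / Real.log x ^ A₅ := by ring

end BFI

end Literature.NumberTheory.Sieve
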